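import Summits.BirchSwinnertonDyer.BirchSwinnertonDyer.Theorems.ByReductionTypeAtTwoTowerLayerTorsionRank
import Summits.BirchSwinnertonDyer.BirchSwinnertonDyer.Theorems.ByReductionTypeAtTwoTowerClassKitE
import Summits.BirchSwinnertonDyer.BirchSwinnertonDyer.Theorems.ByReductionTypeAtTwoTowerKerTwoTorsion
import Summits.BirchSwinnertonDyer.Rank1Residual.GaloisImage.AbelianExtensionTorsionFields
import Literature.NumberTheory.EllipticCurves.ComplexMultiplicationHasCMProofs
import HarnessLib

/-!
# TOWER-road class instances — KIT, part R: the torsion-tolerant gap doors charging only the `2`-RANK of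
# `E(ℚ_∞)[2^∞]` (`hrk : #E(ℚ_∞)[2] ≤ 2^t`), with `t = 2` discharged for EVERY curve and `t = 0` for irreducible `E[2]`
# (route ByReductionTypeAtTwo, items 19271 / 19573, the 86 INELIG classes; seat bsd-2adic-tower-1 GEN 6, part 2 of 2)

HONEST FRAMING (cell `bsd-2adic`, run/shared/lean/pub/bsd-2adic/, HUMAN RULINGS D-0036 / D-0054 / D-0074):
THEOREMS ONLY; nothing asserted; no definition; no new named fact; closes nothing by itself; BSD is not
proved by any of this.

Part 1 (`…TowerLayerTorsionRank`) showed that the torsion charge of the layer count is `#(ker h_j)[2] ≤ #E(ℚ_∞)[2]`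
(the `2`-rank of `B = E(ℚ_∞)[2^∞]`), not `#ker h_j = #E(ℚ_j)[2^∞]`. This part:

* §4 (`K = ℚ`, `p = 2`): **`TowerClass.towerGapAtTwo_of_counts_of_torsionRank`** (+ `_print` form with Greenberg's
  PRINT `hB = Greenberg1999.finite_torsion_cyclotomicZpExtension`): the GEN-4 STRICT-lower-count door
  `…_of_counts_of_torsion` with `htor : #E[2^∞]^{Gal(ℚ̄/ℚ_j)} ≤ 2^t` replaced by
  `hrk : #{b ∈ E[2^∞]^{Gal(ℚ̄/ℚ_∞)} : 2b = 0} ≤ 2^t` — a bound on the `2`-torsion points of `E(ℚ̄)` defined over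
  `ℚ_∞`, INDEPENDENT of the layer `j` and of any auxiliary prime `ℓ`; certificate `d + t + 1 ≤ 2^{j'} − 2^j + a`
  unchanged. The `A`-currency twin is ord-3 GEN 7's `towerGapAtTwo_of_classCounts_of_infTwoTorsion[_of_hB]`
  (`…TowerKerTwoTorsion`, landed the same hour with the same binder shape `hinf`; reused below, not restated).
* §5 dischargers: `natCard_twoTorsion_fixedPoints_kerSubgroup_le_four` — **`t = 2` for EVERY elliptic curve**
  (`#E[2] = 2²`, tree `natCard_torsionBy_geomPoints`): the "safe reading" `t = 2` of the INELIG class files needs NO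
  point-count certificate (doors `towerGapAtTwo_of_counts_rankTwo` / `towerGapAtTwo_of_classCounts_rankTwo` — the
  latter through ord-3's `…_of_classCounts_of_infTwoTorsion_of_hB` —, certificate `d + 3 ≤ 2^{j'} − 2^j + a`); `…_eq_one_of_irreducible` — `t = 0` when `E[2]` is irreducible (tree
  `GaloisImage.fixedPoints_kerSubgroup_eq_bot_of_irreducible`): KitC's torsion-free count without `2 ∤ #E(ℚ)_tors`.
  The sharp `t = 1` — `E(ℚ)[2] ≅ ℤ/2` and the other two `2`-division points NOT defined over `ℚ(√2)`, the only
  quadratic subfield of `ℚ_∞` — is NOT in this file (it needs the Galois dictionary `E[2] ↔` roots of the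
  `2`-division cubic; ord-3 GEN 7 announces a Frobenius certificate for it, `…TowerInfTwoTorsionCertificate`). On the X5@2
  INELIG habitat it concerns exactly the 8 classes 64815e, 74025w, 88723d, 108885a, 117925d, 299775b, 354603d,
  367575bo (24 members): every good `ℓ ≡ ±1 (mod 2^{j+2})`, `ℓ < 3000`, has `4 ∣ #Ẽ(𝔽_ℓ)` there (rational
  `4`-isogeny structure), so no point count certifies `t = 1`, although `dim E(ℚ_j)[2] = 1` at every layer
  (tower-eng TABLE-TOWER-E1 column `t_j`; seat scratch `tcert.py`). For them `t = 1` would move the closing layer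
  pair down by one layer (e.g. 299775b1 / 117925d1 / 74025w1 close at `(0,2)`/`(1,2)` instead of `(·,3)`).

References: [GreenbergLNM1716] R. Greenberg, LNM 1716 (1999), §1 p. 60 and p. 62, §3 pp. 85–86 (Lemmas 3.1,
3.2), §4 Lemma 4.3 (p. 103); [Washington1997] §13.2; [SilvermanAEC2009] Cor. III.6.4(b); [Mazur1977] III §5.
-/

set_option autoImplicit false
-- the route's Theorems namespace repeats a component by design (summit = sub-problem, D-0017).
set_option linter.dupNamespace false

noncomputable section

open scoped Classical

open WeierstrassCurve Literature.NumberTheory.EllipticCurves PowerSeries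
  Summit.BirchSwinnertonDyer.Rank1Residual Summit.BirchSwinnertonDyer.Rank1Residual.X5.TowerGap

universe u

/-! ## §4 The doors charging the `2`-rank of `E(ℚ_∞)[2^∞]` -/

namespace Summit.BirchSwinnertonDyer.BirchSwinnertonDyer.Theorems.TowerClass

open Summit.BirchSwinnertonDyer.Rank1Residual.X5.O1 Summit.BirchSwinnertonDyer.BirchSwinnertonDyer.Theorems

variable (W : WeierstrassCurve ℚ) [W.IsElliptic]

/-- **Tower gap with rational `2`-torsion, charging only the `2`-rank of `E(ℚ_∞)[2^∞]`.** Granted the finiteness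
of `B = E(ℚ_∞)[2^∞]` (`hB`): a STRICT lower count `2^a ≤ #Sel_{2^∞}(E/ℚ_j)[2]`, an upper count `#A_{j'}[2] ≤ 2^d`,
a RANK count `#E(ℚ_∞)[2] ≤ 2^t` (the `2`-torsion points of `E(ℚ̄)` fixed by `Gal(ℚ̄/ℚ_∞)`) and
`d + t + 1 ≤ 2^{j'} − 2^j + a` give `O1.TowerGapAtTwo W`:
`#T_{j'} ≤ #A_{j'}[2] ≤ 2^d < 2^{2^{j'}−2^j}·2^{a−t} ≤ 2^{2^{j'}−2^j}·#T_j` with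
`#Sel_j[2] ≤ #(ker h_j)[2]·#T_j ≤ #B[2]·#T_j` (§§2–3). [cite: GreenbergLNM1716, §1 p. 60, §3 pp. 85–86, §4 Lemma 4.3]
[cite: Washington1997, §13.2] -/
theorem towerGapAtTwo_of_counts_of_torsionRank
    (hB : ∀ κ : ZpExtension ℚ 2, κ.IsCyclotomic →
      Finite (FixedPoints.addSubgroup κ.kerSubgroup (geomPrimaryTorsion W 2)))
    {j j' a d t : ℕ} (hjj' : j ≤ j')
    (hlow : ∀ κ : ZpExtension ℚ 2, κ.IsCyclotomic →
      2 ^ a ≤ Nat.card {z : W.selmerLayer κ j // 2 • z = 0})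
    (hrk : ∀ κ : ZpExtension ℚ 2, κ.IsCyclotomic →
      Nat.card {b : FixedPoints.addSubgroup κ.kerSubgroup (geomPrimaryTorsion W 2) // 2 • b = 0} ≤ 2 ^ t)
    (hup : ∀ κ : ZpExtension ℚ 2, κ.IsCyclotomic →
      Nat.card {z : W.selmerInftyPreimage κ j' // 2 • z = 0} ≤ 2 ^ d)
    (had : d + t + 1 ≤ 2 ^ j' - 2 ^ j + a) : TowerGapAtTwo W := by
  intro κ γ hκ hγ _ D
  haveI : Module.Finite (IwasawaAlgebra 2) D.X := D.module_finite_holds hγ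
  haveI := hB κ hκ
  have hfinj : Finite (W.layerToInfty κ j).ker := TowerLayer.finite_ker_layerToInfty W κ j
  have hfinj' : Finite (W.layerToInfty κ j').ker := TowerLayer.finite_ker_layerToInfty W κ j'
  have hTj : Finite {s : W.selmerInfty κ // 2 • s = 0 ∧
      W.conjH1 2 κ.kerSubgroup (γ ^ 2 ^ j) (s : W.subgroupH1 2 κ.kerSubgroup) = s} :=
    TowerLayer.finite_fixedPTorsion D j
  refine ⟨2 ^ j, 2 ^ j' - 2 ^ j, ?_⟩
  rw [Nat.add_sub_cancel' (Nat.pow_le_pow_right (by norm_num) hjj')]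
  have ej' : Nat.card (D.X ⧸ (towerIdeal 2 (2 ^ j') • ⊤ : Submodule (IwasawaAlgebra 2) D.X)) =
      Nat.card {s : W.selmerInfty κ // 2 • s = 0 ∧
        W.conjH1 2 κ.kerSubgroup (γ ^ 2 ^ j') (s : W.subgroupH1 2 κ.kerSubgroup) = s} := by
    rw [← KatoHalfPinch.layerIdeal_eq_towerIdeal, TowerLayer.natCard_quotient_layerIdeal_eq D j']
  have ej : Nat.card (D.X ⧸ (towerIdeal 2 (2 ^ j) • ⊤ : Submodule (IwasawaAlgebra 2) D.X)) =
      Nat.card {s : W.selmerInfty κ // 2 • s = 0 ∧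
        W.conjH1 2 κ.kerSubgroup (γ ^ 2 ^ j) (s : W.subgroupH1 2 κ.kerSubgroup) = s} := by
    rw [← KatoHalfPinch.layerIdeal_eq_towerIdeal, TowerLayer.natCard_quotient_layerIdeal_eq D j]
  have hK : Nat.card {y : (W.layerToInfty κ j).ker // 2 • y = 0} ≤ 2 ^ t :=
    (TowerLayer.natCard_pTorsion_ker_layerToInfty_le W κ j).trans (hrk κ hκ)
  have h1 : 2 ^ a ≤ 2 ^ t * Nat.card {s : W.selmerInfty κ // 2 • s = 0 ∧
      W.conjH1 2 κ.kerSubgroup (γ ^ 2 ^ j) (s : W.subgroupH1 2 κ.kerSubgroup) = s} :=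
    (hlow κ hκ).trans ((TowerLayer.natCard_selmerLayer_pTorsion_le_pTorsionKer_mul W κ γ j hfinj hTj).trans
      (Nat.mul_le_mul_right _ hK))
  rw [ej', ej]
  have key : 2 ^ t * 2 ^ d < 2 ^ t * (2 ^ (2 ^ j' - 2 ^ j) * Nat.card {s : W.selmerInfty κ // 2 • s = 0 ∧
      W.conjH1 2 κ.kerSubgroup (γ ^ 2 ^ j) (s : W.subgroupH1 2 κ.kerSubgroup) = s}) :=
    calc 2 ^ t * 2 ^ d = 2 ^ (t + d) := (pow_add _ _ _).symm
      _ < 2 ^ (2 ^ j' - 2 ^ j + a) := Nat.pow_lt_pow_right (by norm_num) (by omega)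
      _ = 2 ^ (2 ^ j' - 2 ^ j) * 2 ^ a := pow_add _ _ _
      _ ≤ 2 ^ (2 ^ j' - 2 ^ j) * (2 ^ t * Nat.card {s : W.selmerInfty κ // 2 • s = 0 ∧
          W.conjH1 2 κ.kerSubgroup (γ ^ 2 ^ j) (s : W.subgroupH1 2 κ.kerSubgroup) = s}) :=
        Nat.mul_le_mul_left _ h1
      _ = 2 ^ t * (2 ^ (2 ^ j' - 2 ^ j) * Nat.card {s : W.selmerInfty κ // 2 • s = 0 ∧
          W.conjH1 2 κ.kerSubgroup (γ ^ 2 ^ j) (s : W.subgroupH1 2 κ.kerSubgroup) = s}) := by ring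
  calc Nat.card {s : W.selmerInfty κ // 2 • s = 0 ∧
        W.conjH1 2 κ.kerSubgroup (γ ^ 2 ^ j') (s : W.subgroupH1 2 κ.kerSubgroup) = s}
      ≤ Nat.card {z : W.selmerInftyPreimage κ j' // 2 • z = 0} :=
        TowerLayer.natCard_fixedPTorsion_le_natCard_layerClasses_of_finite_ker W κ hγ j' hfinj'
    _ ≤ 2 ^ d := hup κ hκ
    _ < _ := Nat.lt_of_mul_lt_mul_left key

/-! ## §5 Dischargers of the rank binder: `t = 2` always, `t = 0` for irreducible `E[2]` -/

/-- **`#E(ℚ_∞)[2] ≤ 4` for every curve** (indeed for every `ℤ₂`-extension `κ` of `ℚ`): the `2`-torsion of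
`B = E[2^∞]^{Gal(ℚ̄/ℚ_∞)}` injects into `E(ℚ̄)[2]`, which has `2² = 4` elements (tree
`natCard_torsionBy_geomPoints`, Silverman *AEC* III.6.4(b)). [cite: SilvermanAEC2009, Cor. III.6.4(b)] -/
theorem natCard_twoTorsion_fixedPoints_kerSubgroup_le_four (κ : ZpExtension ℚ 2) :
    Nat.card {b : FixedPoints.addSubgroup κ.kerSubgroup (geomPrimaryTorsion W 2) // 2 • b = 0} ≤ 2 ^ 2 := by
  have h4 : Nat.card (AddSubgroup.torsionBy W.geomPoints ((2 : ℕ) : ℤ)) = 2 ^ 2 := by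
    rw [W.natCard_torsionBy_geomPoints (by norm_num)]; norm_num
  haveI : Finite (AddSubgroup.torsionBy W.geomPoints ((2 : ℕ) : ℤ)) :=
    Nat.finite_of_card_ne_zero (by rw [h4]; norm_num)
  rw [← h4]
  refine Nat.card_le_card_of_injective
    (fun b ↦ (⟨(((b.1 : FixedPoints.addSubgroup κ.kerSubgroup (geomPrimaryTorsion W 2)) :
      geomPrimaryTorsion W 2) : W.geomPoints), ?_⟩ : AddSubgroup.torsionBy W.geomPoints ((2 : ℕ) : ℤ))) ?_
  · rw [AddSubgroup.torsionBy.nsmul_iff]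
    have := congrArg (fun z : FixedPoints.addSubgroup κ.kerSubgroup (geomPrimaryTorsion W 2) ↦
      ((z : geomPrimaryTorsion W 2) : W.geomPoints)) b.2
    simpa only [AddSubgroupClass.coe_nsmul, ZeroMemClass.coe_zero] using this
  · intro b b' hbb'
    have := congrArg (fun z : AddSubgroup.torsionBy W.geomPoints ((2 : ℕ) : ℤ) ↦ (z : W.geomPoints)) hbb'
    exact Subtype.ext (Subtype.ext (Subtype.ext this))

/-- **`#E(ℚ_∞)[2] = 1` when `E[2]` is irreducible** (any `ℤ₂`-extension): `B = E(ℚ_∞)[2^∞] = 0`, tree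
`GaloisImage.fixedPoints_kerSubgroup_eq_bot_of_irreducible` (Mazur: a rational point of order `2` contradicts
irreducibility; then the pro-`2` ascent). [cite: GreenbergLNM1716, §1 p. 62 and §4 p. 109] -/
theorem natCard_twoTorsion_fixedPoints_kerSubgroup_eq_one_of_irreducible
    (hirr : W.HasIrreducibleModPGaloisRep 2) (κ : ZpExtension ℚ 2) :
    Nat.card {b : FixedPoints.addSubgroup κ.kerSubgroup (geomPrimaryTorsion W 2) // 2 • b = 0} = 2 ^ 0 := by
  have hbot := GaloisImage.fixedPoints_kerSubgroup_eq_bot_of_irreducible W 2 hirr κ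
  rw [pow_zero, Nat.card_eq_one_iff_unique]
  refine ⟨⟨fun b b' ↦ ?_⟩, ⟨⟨0, smul_zero _⟩⟩⟩
  have hb : (b.1 : FixedPoints.addSubgroup κ.kerSubgroup (geomPrimaryTorsion W 2)) = 0 :=
    Subtype.ext ((AddSubgroup.eq_bot_iff_forall _).mp hbot _ b.1.2)
  have hb' : (b'.1 : FixedPoints.addSubgroup κ.kerSubgroup (geomPrimaryTorsion W 2)) = 0 :=
    Subtype.ext ((AddSubgroup.eq_bot_iff_forall _).mp hbot _ b'.1.2)
  exact Subtype.ext (hb.trans hb'.symm)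

/-- **The torsion-tolerant door with `t = 2` BUILT IN — no torsion certificate at all** (PRINT `hB`, strict lower
count at `j`, upper count at `j'`, `d + 3 ≤ 2^{j'} − 2^j + a`). [cite: GreenbergLNM1716, §1 p. 60 and p. 62,
§3 pp. 85–86, §4 Lemma 4.3] [cite: SilvermanAEC2009, Cor. III.6.4(b)] -/
theorem towerGapAtTwo_of_counts_rankTwo (hB : Greenberg1999.finite_torsion_cyclotomicZpExtension)
    {j j' a d : ℕ} (hjj' : j ≤ j')
    (hlow : ∀ κ : ZpExtension ℚ 2, κ.IsCyclotomic →
      2 ^ a ≤ Nat.card {z : W.selmerLayer κ j // 2 • z = 0})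
    (hup : ∀ κ : ZpExtension ℚ 2, κ.IsCyclotomic →
      Nat.card {z : W.selmerInftyPreimage κ j' // 2 • z = 0} ≤ 2 ^ d)
    (had : d + 2 + 1 ≤ 2 ^ j' - 2 ^ j + a) : TowerGapAtTwo W :=
  towerGapAtTwo_of_counts_of_torsionRank W (fun κ hκ ↦ hB W 2 κ hκ) hjj' hlow
    (fun κ _ ↦ natCard_twoTorsion_fixedPoints_kerSubgroup_le_four W κ) hup had

/-- **The `A`-currency door with `t = 2` BUILT IN** (through ord-3 GEN 7's `towerGapAtTwo_of_classCounts_of_infTwoTorsion_of_hB`). [cite: GreenbergLNM1716, §1 p. 60 and p. 62, §3 pp. 85–86,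
§4 Lemma 4.3] [cite: SilvermanAEC2009, Cor. III.6.4(b)] -/
theorem towerGapAtTwo_of_classCounts_rankTwo (hB : Greenberg1999.finite_torsion_cyclotomicZpExtension)
    {j j' a d : ℕ} (hjj' : j ≤ j')
    (hlow : ∀ κ : ZpExtension ℚ 2, κ.IsCyclotomic →
      2 ^ a ≤ Nat.card {z : W.selmerInftyPreimage κ j // 2 • z = 0})
    (hup : ∀ κ : ZpExtension ℚ 2, κ.IsCyclotomic →
      Nat.card {z : W.selmerInftyPreimage κ j' // 2 • z = 0} ≤ 2 ^ d)
    (had : d + 2 + 1 ≤ 2 ^ j' - 2 ^ j + a) : TowerGapAtTwo W :=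
  towerGapAtTwo_of_classCounts_of_infTwoTorsion_of_hB W hB hjj' hlow
    (fun κ _ ↦ natCard_twoTorsion_fixedPoints_kerSubgroup_le_four W κ) hup had

/-- **The torsion-rank doors with PRINT `hB` and a displayed rank count** (for the sharp `t = 1` rows).
[cite: GreenbergLNM1716, §1 p. 60 and p. 62, §3 pp. 85–86, §4 Lemma 4.3] -/
theorem towerGapAtTwo_of_counts_of_torsionRank_print (hB : Greenberg1999.finite_torsion_cyclotomicZpExtension)
    {j j' a d t : ℕ} (hjj' : j ≤ j')
    (hlow : ∀ κ : ZpExtension ℚ 2, κ.IsCyclotomic →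
      2 ^ a ≤ Nat.card {z : W.selmerLayer κ j // 2 • z = 0})
    (hrk : ∀ κ : ZpExtension ℚ 2, κ.IsCyclotomic →
      Nat.card {b : FixedPoints.addSubgroup κ.kerSubgroup (geomPrimaryTorsion W 2) // 2 • b = 0} ≤ 2 ^ t)
    (hup : ∀ κ : ZpExtension ℚ 2, κ.IsCyclotomic →
      Nat.card {z : W.selmerInftyPreimage κ j' // 2 • z = 0} ≤ 2 ^ d)
    (had : d + t + 1 ≤ 2 ^ j' - 2 ^ j + a) : TowerGapAtTwo W :=
  towerGapAtTwo_of_counts_of_torsionRank W (fun κ hκ ↦ hB W 2 κ hκ) hjj' hlow hrk hup had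

end Summit.BirchSwinnertonDyer.BirchSwinnertonDyer.Theorems.TowerClass

end
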